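import Literature.Probability.RandomPlanarGeometry.ObservableLimitPassage
import Literature.Probability.Process.ExtendedContinuousMapping
import HarnessLib

/-!
# The martingale property passes to the scaling limit: functionals continuous at almost every limit path

Topic `Literature/Probability/RandomPlanarGeometry` (weak-convergence tools for the martingale
observable method; theorems only, no definition, no named fact). Sequel of
`ObservableLimitPassage.lean`, whose passage theorem
`Loewner.integral_cylinder_eq_zero_of_tendstoInDistribution` asks the family of path functionals
`N_u(w)` to be JOINTLY CONTINUOUS on `ℝ≥0 × C([0, ∞), ℝ)`.  That is the right hypothesis for the
time-limited FK-Ising observable at an interior point (deterministic horizon `T(iy) = y²/9`), but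
not for LEVEL-STOPPED boundary observables such as the crossing observables
`N_u(w) = f(η_{u ∧ ρ(w)}(w))` of percolation (Smirnov 2001; Camia–Newman 2007, §§5–7; Werner 2007,
§4): the level stopping time `ρ(w)` (first exit of the mark flows from a level box) is lower
semicontinuous in the path and continuous exactly at paths leaving the closed box immediately after
the exit, which is an almost sure event for the scaling limit at all but countably many levels, never
a sure one.  This file proves the passage theorem under the hypotheses such functionals do satisfy:

* `N` is measurable in the path for each time, continuous in time along EVERY path, bounded, and
  jointly continuous at `(u, w)` for all `u` for `μ`-ALMOST EVERY limit path `w = W(ω)`.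

Results (all PROVED):

* `Process.tendsto_integral_comp_of_tendstoInDistribution_of_ae_continuousAt` — if `X n → Z` in
  distribution on a pseudo-emetric space and `g` is real, bounded, measurable and continuous at
  a.e. point of the law of `Z`, then `E[g(X n)] → E[g(Z)]` (the almost-continuous mapping theorem
  of `ExtendedContinuousMapping.lean` plus a clipped identity test function);
* `Loewner.measurable_sSup_norm_sub`, `Loewner.continuousAt_sSup_norm_sub` — the oscillation
  functional `w ↦ sup_{u ∈ [t, t+Δ]} ‖N_u(w) − N_t(w)‖` is measurable (supremum over a dense
  sequence of times, by pathwise continuity) and continuous at every path at which `N` is jointly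
  continuous at all times (compactness of the time interval);
* `Loewner.integral_cylinder_eq_zero_of_tendstoInDistribution_of_ae_continuousAt` — the passage
  theorem in this form (real functionals and real per-scale martingale values).

## References

* D. Chelkak, H. Duminil-Copin, C. Hongler, A. Kemppainen, S. Smirnov, C. R. Math. Acad. Sci.
  Paris 352 (2014) 157–161, §3. [CDHKSCRAS2014]
* H. Duminil-Copin, S. Smirnov, Clay Math. Proc. 15 (2012) 213–276, proof of Prop. 6.7.
  [DuminilCopinSmirnov2012Clay]
* F. Camia, C. M. Newman, Probab. Theory Related Fields 139 (2007) 473–519, §§5–7 (crossing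
  martingales of the percolation exploration path). [CamiaNewman2007]
* P. Billingsley, *Convergence of Probability Measures*, 2nd ed. (1999), Thm. 2.7. [Billingsley1999]
-/

noncomputable section

open MeasureTheory Filter Topology Set Metric
open scoped NNReal ENNReal BoundedContinuousFunction

/-! ### Integrals of bounded almost-continuous functionals converge -/

namespace Literature.Probability.Process

section AEContinuous

variable {E : Type*} [MeasurableSpace E] [PseudoEMetricSpace E] [OpensMeasurableSpace E]
  {Ω : ℕ → Type*} {mΩ : ∀ n, MeasurableSpace (Ω n)} {P : ∀ n, Measure (Ω n)}
  [∀ n, IsProbabilityMeasure (P n)] {Ω' : Type*} {mΩ' : MeasurableSpace Ω'} {P' : Measure Ω'}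
  [IsProbabilityMeasure P'] {X : ∀ n, Ω n → E} {Z : Ω' → E}

/-- The clipped identity `x ↦ max (-C) (min x C)` as a bounded continuous function. [folklore] -/
theorem exists_bcf_clip (C : ℝ) :
    ∃ φ : ℝ →ᵇ ℝ, ∀ x, φ x = max (-C) (min x C) := by
  refine ⟨BoundedContinuousFunction.ofNormedAddCommGroup (fun x ↦ max (-C) (min x C))
    (continuous_const.max (continuous_id.min continuous_const)) |C| fun x ↦ ?_, fun x ↦ rfl⟩
  rw [Real.norm_eq_abs, abs_le]
  constructor
  · exact (neg_le_neg (le_abs_self C)).trans (le_max_left _ _)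
  · exact max_le ((neg_le.1 (neg_abs_le C))) ((min_le_right _ _).trans (le_abs_self C))

/-- **Expectations of a bounded almost-continuous functional converge along convergence in
distribution.**  If `X n → Z` in distribution (pseudo-emetric space), `g` is real, measurable,
bounded, and continuous at `Z ω` for a.e. `ω`, then `∫ g (X n) dP n → ∫ g Z dP'`.
(Billingsley 1999, Thm. 2.7, with a bounded test function.) [cite: Billingsley1999, Thm. 2.7] -/
theorem tendsto_integral_comp_of_tendstoInDistribution_of_ae_continuousAt
    (hX : TendstoInDistribution X atTop Z P P') {g : E → ℝ} (hgm : Measurable g) {C : ℝ}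
    (hgC : ∀ x, ‖g x‖ ≤ C) (hcont : ∀ᵐ ω ∂P', ContinuousAt g (Z ω)) :
    Tendsto (fun n ↦ ∫ ω, g (X n ω) ∂P n) atTop (𝓝 (∫ ω, g (Z ω) ∂P')) := by
  -- continuity at a.e. point of the law of `Z`
  have hcont' : ∀ᵐ x ∂(P'.map Z), ContinuousAt g x :=
    (ae_map_iff hX.aemeasurable_limit (IsGδ.setOf_continuousAt g).measurableSet).2 hcont
  -- the almost-continuous mapping theorem: `g (X n) → g Z` in distribution
  have hcomp : TendstoInDistribution (fun n ↦ g ∘ X n) atTop (g ∘ Z) P P' := by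
    refine tendstoInDistribution_comp_of_forall_exists_seq_tendsto (F' := ℝ) hX (fun _ ↦ hgm) hgm
      fun ε _ ↦ ⟨fun _ ↦ univ, fun _ ↦ MeasurableSet.univ, Eventually.of_forall fun n ↦ by simp, ?_⟩
    filter_upwards [hcont'] with x hx u _ xs _ hxs
    exact hx.tendsto.comp hxs
  -- integrate the clipped identity, which is the identity on the range of `g`
  obtain ⟨φ, hφ⟩ := exists_bcf_clip C
  have hφg : ∀ x, φ (g x) = g x := fun x ↦ by
    have h := abs_le.1 ((Real.norm_eq_abs _).symm.trans_le (hgC x))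
    rw [hφ, min_eq_left h.2, max_eq_right h.1]
  have key := (ProbabilityMeasure.tendsto_iff_forall_integral_tendsto.1 hcomp.tendsto) φ
  simp only [ProbabilityMeasure.coe_mk] at key
  rw [integral_map (hgm.comp_aemeasurable hX.aemeasurable_limit)
    φ.continuous.aestronglyMeasurable] at key
  simp only [Function.comp_apply, hφg] at key
  refine key.congr fun n ↦ ?_
  rw [integral_map (hgm.comp_aemeasurable (hX.forall_aemeasurable n))
    φ.continuous.aestronglyMeasurable]
  simp only [Function.comp_apply, hφg]

end AEContinuous

end Literature.Probability.Process

namespace Literature.Probability.RandomPlanarGeometry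

namespace Loewner

/-! ### The oscillation functional: measurability and continuity at good paths -/

section Oscillation

variable {N : ℝ≥0 → C(ℝ≥0, ℝ) → ℝ}

/-- **A supremum over a compact time interval of a pathwise-continuous, pathwise-measurable
family is measurable**: it is the supremum over a dense sequence of times. [folklore] -/
theorem measurable_sSup_norm_sub [MeasurableSpace C(ℝ≥0, ℝ)]
    (hNm : ∀ u, Measurable (N u)) (hNu : ∀ w, Continuous fun u ↦ N u w) (t Δ : ℝ≥0) :
    Measurable fun w : C(ℝ≥0, ℝ) ↦ sSup ((fun u ↦ ‖N u w - N t w‖) '' Icc t (t + Δ)) := by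
  haveI : Nonempty (Icc t (t + Δ)) := ⟨⟨t, le_rfl, le_self_add⟩⟩
  obtain ⟨d, hd⟩ := TopologicalSpace.exists_dense_seq (Icc t (t + Δ))
  -- the oscillation along one path, as a continuous function of time
  set h : ℝ≥0 → C(ℝ≥0, ℝ) → ℝ := fun u w ↦ ‖N u w - N t w‖ with hh
  have hhc : ∀ w, Continuous fun u ↦ h u w := fun w ↦ ((hNu w).sub continuous_const).norm
  have hhm : ∀ u, Measurable (h u) := fun u ↦ ((hNm u).sub (hNm t)).norm
  have hbdd : ∀ w, BddAbove ((fun u ↦ h u w) '' Icc t (t + Δ)) := fun w ↦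
    isCompact_Icc.bddAbove_image (hhc w).continuousOn
  have hbdd' : ∀ w, BddAbove (range fun n ↦ h (d n) w) := fun w ↦
    (hbdd w).mono (by rintro _ ⟨n, rfl⟩; exact ⟨d n, (d n).2, rfl⟩)
  -- the supremum over the interval is the supremum over the dense sequence
  have heq : ∀ w, sSup ((fun u ↦ h u w) '' Icc t (t + Δ)) = ⨆ n, h (d n) w := by
    intro w
    apply le_antisymm
    · refine csSup_le ⟨_, t, ⟨le_rfl, le_self_add⟩, rfl⟩ ?_
      rintro _ ⟨u, hu, rfl⟩
      -- `u` is a limit of points of the dense sequence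
      have hmem : (⟨u, hu⟩ : Icc t (t + Δ)) ∈ closure (range d) := by
        rw [hd.closure_eq]; exact mem_univ _
      obtain ⟨xs, hxs, hlim⟩ := mem_closure_iff_seq_limit.1 hmem
      choose ns hns using fun j ↦ mem_range.1 (hxs j)
      have hlim' : Tendsto (fun j ↦ ((d (ns j) : Icc t (t + Δ)) : ℝ≥0)) atTop (𝓝 u) := by
        have := (continuous_subtype_val.tendsto _).comp hlim
        refine this.congr fun j ↦ ?_
        simp only [Function.comp_apply, hns j]
      have hconv : Tendsto (fun j ↦ h (d (ns j)) w) atTop (𝓝 (h u w)) :=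
        ((hhc w).tendsto u).comp hlim'
      exact le_of_tendsto' hconv fun j ↦ le_ciSup (hbdd' w) (ns j)
    · exact ciSup_le fun n ↦ le_csSup (hbdd w) ⟨d n, (d n).2, rfl⟩
  rw [show (fun w : C(ℝ≥0, ℝ) ↦ sSup ((fun u ↦ ‖N u w - N t w‖) '' Icc t (t + Δ))) =
      fun w ↦ ⨆ n, h (d n) w from funext heq]
  exact Measurable.iSup fun n ↦ hhm (d n)

/-- **The oscillation functional is continuous at every path at which the family is jointly
continuous at all times** (compactness of the time interval: the supremum of a bounded family of
functions continuous at a point, jointly in a compact parameter, is continuous at the point).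
[folklore] -/
theorem continuousAt_sSup_norm_sub {C : ℝ} (hNC : ∀ u w, ‖N u w‖ ≤ C) {w₀ : C(ℝ≥0, ℝ)}
    (hc : ∀ u, ContinuousAt (Function.uncurry N) (u, w₀)) (t Δ : ℝ≥0) :
    ContinuousAt (fun w : C(ℝ≥0, ℝ) ↦ sSup ((fun u ↦ ‖N u w - N t w‖) '' Icc t (t + Δ))) w₀ := by
  set h : ℝ≥0 → C(ℝ≥0, ℝ) → ℝ := fun u w ↦ ‖N u w - N t w‖ with hh
  set Sup : C(ℝ≥0, ℝ) → ℝ := fun w ↦ sSup ((fun u ↦ h u w) '' Icc t (t + Δ)) with hSup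
  have hne : ∀ w, ((fun u ↦ h u w) '' Icc t (t + Δ)).Nonempty := fun w ↦
    ⟨_, t, ⟨le_rfl, le_self_add⟩, rfl⟩
  have hbd : ∀ u w, h u w ≤ 2 * C := fun u w ↦
    (norm_sub_le _ _).trans (by linarith [hNC u w, hNC t w])
  have hbdd : ∀ w, BddAbove ((fun u ↦ h u w) '' Icc t (t + Δ)) := fun w ↦
    ⟨2 * C, by rintro _ ⟨u, -, rfl⟩; exact hbd u w⟩
  -- joint continuity of `(w, u) ↦ h u w` at `(w₀, u)` for every `u`
  have hjoint : ∀ u, ContinuousAt (fun p : C(ℝ≥0, ℝ) × ℝ≥0 ↦ h p.2 p.1) (w₀, u) := by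
    intro u
    have h1 : ContinuousAt (fun p : C(ℝ≥0, ℝ) × ℝ≥0 ↦ N p.2 p.1) (w₀, u) :=
      (hc u).comp_of_eq (continuousAt_snd.prodMk continuousAt_fst) rfl
    have h2 : ContinuousAt (fun p : C(ℝ≥0, ℝ) × ℝ≥0 ↦ N t p.1) (w₀, u) :=
      (hc t).comp_of_eq (continuousAt_const.prodMk continuousAt_fst) rfl
    exact (h1.sub h2).norm
  rw [ContinuousAt, tendsto_order]
  constructor
  · -- lower bound: a near-maximiser at `w₀` stays large nearby
    intro a ha
    obtain ⟨_, ⟨u₀, hu₀, rfl⟩, hlt⟩ := exists_lt_of_lt_csSup (hne w₀) ha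
    have hw : ContinuousAt (fun w : C(ℝ≥0, ℝ) ↦ h u₀ w) w₀ :=
      (hjoint u₀).comp_of_eq (continuousAt_id.prodMk continuousAt_const) rfl
    filter_upwards [hw.eventually (Ioi_mem_nhds hlt)] with w hw'
    exact lt_of_lt_of_le hw' (le_csSup (hbdd w) ⟨u₀, hu₀, rfl⟩)
  · -- upper bound: uniformly in the compact time interval
    intro b hb
    obtain ⟨e, he, heb⟩ : ∃ e, 0 < e ∧ Sup w₀ + e < b := ⟨(b - Sup w₀) / 2, by linarith, by linarith⟩
    have hP : ∀ u ∈ Icc t (t + Δ), ∀ᶠ z : C(ℝ≥0, ℝ) × ℝ≥0 in 𝓝 (w₀, u), h z.2 z.1 < Sup w₀ + e := by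
      intro u hu
      have hle : h u w₀ ≤ Sup w₀ := le_csSup (hbdd w₀) ⟨u, hu, rfl⟩
      exact (hjoint u).eventually (Iio_mem_nhds (by linarith))
    have hev := isCompact_Icc.eventually_forall_of_forall_eventually
      (P := fun w u ↦ h u w < Sup w₀ + e) hP
    filter_upwards [hev] with w hw
    refine lt_of_le_of_lt (csSup_le (hne w) ?_) heb
    rintro _ ⟨u, hu, rfl⟩
    exact (hw u hu).le

/-- Elementary bounds on the oscillation functional of a REAL family (the real twin of
`sSup_norm_sub_bounds`): nonnegative, at most `2C` if `‖N‖ ≤ C`, and dominating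
`‖N_u(w) - N_t(w)‖` on `[t, t + Δ]`. [folklore] -/
theorem sSup_norm_sub_bounds_real {C : ℝ} (hNC : ∀ u w, ‖N u w‖ ≤ C) (t Δ : ℝ≥0)
    (w : C(ℝ≥0, ℝ)) :
    0 ≤ sSup ((fun u ↦ ‖N u w - N t w‖) '' Icc t (t + Δ)) ∧
    sSup ((fun u ↦ ‖N u w - N t w‖) '' Icc t (t + Δ)) ≤ 2 * C ∧
    ∀ u ∈ Icc t (t + Δ), ‖N u w - N t w‖ ≤ sSup ((fun u ↦ ‖N u w - N t w‖) '' Icc t (t + Δ)) := by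
  have hbd : ∀ u, ‖N u w - N t w‖ ≤ 2 * C := fun u ↦
    (norm_sub_le _ _).trans (by linarith [hNC u w, hNC t w])
  have hB : BddAbove ((fun u ↦ ‖N u w - N t w‖) '' Icc t (t + Δ)) :=
    ⟨2 * C, by rintro _ ⟨u, -, rfl⟩; exact hbd u⟩
  have ht : t ∈ Icc t (t + Δ) := ⟨le_rfl, le_self_add⟩
  have hne : ((fun u ↦ ‖N u w - N t w‖) '' Icc t (t + Δ)).Nonempty := ⟨_, t, ht, rfl⟩
  refine ⟨?_, csSup_le hne (by rintro _ ⟨u, -, rfl⟩; exact hbd u),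
    fun u hu ↦ le_csSup hB ⟨u, hu, rfl⟩⟩
  have h0 := le_csSup hB ⟨t, ht, rfl⟩
  simpa using h0

end Oscillation

section Passage

variable {Ω : Type*} {mΩ : MeasurableSpace Ω} {μ : Measure Ω} [IsProbabilityMeasure μ]
  {Ω' : ℕ → Type*} {mΩ' : ∀ k, MeasurableSpace (Ω' k)} {P : ∀ k, Measure (Ω' k)}
  [∀ k, IsProbabilityMeasure (P k)]
  [MeasurableSpace C(ℝ≥0, ℝ)] [OpensMeasurableSpace C(ℝ≥0, ℝ)]

/-- **The martingale property passes to the scaling limit — functionals continuous at almost every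
limit path.**  The abstract passage theorem `integral_cylinder_eq_zero_of_tendstoInDistribution` of
`ObservableLimitPassage.lean` (CDHKS 2014, §3; Duminil-Copin–Smirnov 2012, proof of Prop. 6.7) for a
REAL bounded family of path functionals `N_u(w)` which is measurable in `w`, continuous in `u` along
every path, and jointly continuous at `(u, w)` for every `u` only for `μ`-almost every LIMIT path
`w = W(ω)` — the form needed by LEVEL-STOPPED observables `N_u(w) = f(η_{u ∧ ρ(w)}(w))`, whose level
stopping time `ρ` is a continuous functional of the path only at paths leaving the level box
transversally (an almost sure event for all but countably many levels).  Same setting and conclusion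
otherwise: driving processes `V k → W` in distribution in `C([0, ∞), ℝ)`, a bounded continuous cylinder
test function `ψ(·_S)` at times `S ≤ s`, per-scale random variables `A, B` with the optional-stopping
identity approximating `N_u(V k)` just after `s`, `t` off a small bad event; conclusion
`E_μ[(N_t(W) − N_s(W)) ψ(W_S)] = 0`.  Proof: as in the continuous case, with the almost-continuous
mapping theorem (`Process.tendsto_integral_comp_of_tendstoInDistribution_of_ae_continuousAt`) for the
cylinder functional and for the oscillation functional (measurable by `measurable_sSup_norm_sub`,
continuous at the good paths by `continuousAt_sSup_norm_sub`). [cite: CDHKSCRAS2014, §3]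
[cite: DuminilCopinSmirnov2012Clay, Prop. 6.7 (proof, p. 29)] -/
theorem integral_cylinder_eq_zero_of_tendstoInDistribution_of_ae_continuousAt
    {W : ℝ≥0 → Ω → ℝ} (hWc : ∀ ω, Continuous (W · ω))
    {V : ∀ k, ℝ≥0 → Ω' k → ℝ} (hVc : ∀ k ω, Continuous (V k · ω))
    (hlaw : TendstoInDistribution (fun k ω ↦ (⟨fun u ↦ V k u ω, hVc k ω⟩ : C(ℝ≥0, ℝ))) atTop
      (fun ω ↦ (⟨fun u ↦ W u ω, hWc ω⟩ : C(ℝ≥0, ℝ))) P μ)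
    {N : ℝ≥0 → C(ℝ≥0, ℝ) → ℝ} (hNm : ∀ u, Measurable (N u)) (hNu : ∀ w, Continuous fun u ↦ N u w)
    (hNae : ∀ᵐ ω ∂μ, ∀ u, ContinuousAt (Function.uncurry N) (u, ⟨fun r ↦ W r ω, hWc ω⟩)) {C : ℝ}
    (hNC : ∀ u w, ‖N u w‖ ≤ C) (s t : ℝ≥0) {n : ℕ} (S : Fin n → ℝ≥0) {ψ : (Fin n → ℝ) → ℝ}
    (hψc : Continuous ψ) (hψ1 : ∀ v, |ψ v| ≤ 1) {C' : ℝ} {ε Δ η : ℕ → ℝ≥0}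
    (hε : Tendsto ε atTop (𝓝 0)) (hΔ : Tendsto Δ atTop (𝓝 0)) (hη : Tendsto η atTop (𝓝 0))
    (happrox : ∀ k, ∃ (A B : Ω' k → ℝ) (bad : Set (Ω' k)), MeasurableSet bad ∧ P k bad ≤ η k ∧
      AEStronglyMeasurable A (P k) ∧ AEStronglyMeasurable B (P k) ∧
      (∀ᵐ ω ∂P k, ‖A ω‖ ≤ C') ∧ (∀ᵐ ω ∂P k, ‖B ω‖ ≤ C') ∧
      ∫ ω, (B ω - A ω) * ψ (fun i ↦ V k (S i) ω) ∂P k = 0 ∧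
      ∀ᵐ ω ∂P k, ω ∉ bad →
        (∃ u ∈ Icc s (s + Δ k), ‖A ω - N u ⟨fun r ↦ V k r ω, hVc k ω⟩‖ ≤ ε k) ∧
        (∃ u ∈ Icc t (t + Δ k), ‖B ω - N u ⟨fun r ↦ V k r ω, hVc k ω⟩‖ ≤ ε k)) :
    ∫ ω, (N t ⟨fun u ↦ W u ω, hWc ω⟩ - N s ⟨fun u ↦ W u ω, hWc ω⟩) *
      ψ (fun i ↦ W (S i) ω) ∂μ = 0 := by
  -- a pseudo-metric inducing the compact-open topology (the almost-continuous mapping theorem is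
  -- stated on pseudo-emetric spaces)
  letI : PseudoMetricSpace C(ℝ≥0, ℝ) := TopologicalSpace.pseudoMetrizableSpacePseudoMetric _
  -- the path maps
  set pW : Ω → C(ℝ≥0, ℝ) := fun ω ↦ ⟨fun u ↦ W u ω, hWc ω⟩ with hpW
  set pV : ∀ k, Ω' k → C(ℝ≥0, ℝ) := fun k ω ↦ ⟨fun u ↦ V k u ω, hVc k ω⟩ with hpV
  have hpWm : AEMeasurable pW μ := hlaw.aemeasurable_limit
  have hpVm : ∀ k, AEMeasurable (pV k) (P k) := hlaw.forall_aemeasurable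
  -- constants
  have hC0 : 0 ≤ C := (norm_nonneg _).trans (hNC 0 0)
  -- the cylinder functional `F = (N_t - N_s) ψ(·_S)`
  have hevalc : Continuous fun w : C(ℝ≥0, ℝ) ↦ (fun i ↦ w (S i) : Fin n → ℝ) :=
    continuous_pi fun i ↦ continuous_eval_const (S i)
  have hψC : Continuous fun w : C(ℝ≥0, ℝ) ↦ ψ (fun i ↦ w (S i)) := hψc.comp hevalc
  set F : C(ℝ≥0, ℝ) → ℝ := fun w ↦ (N t w - N s w) * ψ (fun i ↦ w (S i)) with hF
  have hFm : Measurable F := ((hNm t).sub (hNm s)).mul hψC.measurable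
  have hFae : ∀ᵐ ω ∂μ, ContinuousAt F (pW ω) := by
    filter_upwards [hNae] with ω hω
    have h1 : ∀ u, ContinuousAt (fun w : C(ℝ≥0, ℝ) ↦ N u w) (pW ω) := fun u ↦
      (hω u).comp_of_eq (continuousAt_const.prodMk continuousAt_id) rfl
    exact ((h1 t).sub (h1 s)).mul hψC.continuousAt
  have hFb : ∀ w, ‖F w‖ ≤ 2 * C := fun w ↦ by
    show ‖(N t w - N s w) * ψ (fun i ↦ w (S i))‖ ≤ 2 * C
    rw [norm_mul, Real.norm_eq_abs (ψ fun i ↦ w (S i))]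
    have h1 : ‖N t w - N s w‖ ≤ 2 * C :=
      (norm_sub_le _ _).trans (by linarith [hNC t w, hNC s w])
    calc ‖N t w - N s w‖ * |ψ fun i ↦ w (S i)| ≤ 2 * C * 1 :=
          mul_le_mul h1 (hψ1 _) (abs_nonneg _) (by linarith)
      _ = 2 * C := mul_one _
  change ∫ ω, F (pW ω) ∂μ = 0
  -- the oscillation functional `G_Δ`
  set G : ℝ≥0 → C(ℝ≥0, ℝ) → ℝ := fun Δ' w ↦
    sSup ((fun u ↦ ‖N u w - N t w‖) '' Icc t (t + Δ')) +
      sSup ((fun u ↦ ‖N u w - N s w‖) '' Icc s (s + Δ')) with hG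
  have hGm : ∀ Δ', Measurable (G Δ') := fun Δ' ↦
    (measurable_sSup_norm_sub hNm hNu t Δ').add (measurable_sSup_norm_sub hNm hNu s Δ')
  have hGae : ∀ Δ', ∀ᵐ ω ∂μ, ContinuousAt (G Δ') (pW ω) := fun Δ' ↦ by
    filter_upwards [hNae] with ω hω
    exact (continuousAt_sSup_norm_sub hNC hω t Δ').add (continuousAt_sSup_norm_sub hNC hω s Δ')
  have hG0 : ∀ Δ' w, 0 ≤ G Δ' w := fun Δ' w ↦
    add_nonneg (sSup_norm_sub_bounds_real hNC t Δ' w).1 (sSup_norm_sub_bounds_real hNC s Δ' w).1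
  have hGb : ∀ Δ' w, G Δ' w ≤ 4 * C := fun Δ' w ↦ by
    have := add_le_add (sSup_norm_sub_bounds_real hNC t Δ' w).2.1 (sSup_norm_sub_bounds_real hNC s Δ' w).2.1
    show _ + _ ≤ 4 * C
    linarith
  have hGnorm : ∀ Δ' w, ‖G Δ' w‖ ≤ 4 * C := fun Δ' w ↦ by
    rw [Real.norm_eq_abs, abs_of_nonneg (hG0 _ _)]; exact hGb _ _
  -- Step 1: for every `Δ' > 0`, `‖E_μ[F(W)]‖ ≤ E_μ[G_Δ'(W)]`
  have hstep : ∀ Δ' : ℝ≥0, 0 < Δ' → ‖∫ ω, F (pW ω) ∂μ‖ ≤ ∫ ω, G Δ' (pW ω) ∂μ := by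
    intro Δ' hΔ'
    -- the estimate at level `k`, when `Δ k ≤ Δ'`
    have hk : ∀ k, Δ k ≤ Δ' → ‖∫ ω, F (pV k ω) ∂P k‖ ≤
        2 * (ε k : ℝ) + ∫ ω, G Δ' (pV k ω) ∂P k + (2 * C + 2 * |C'|) * (η k : ℝ) := by
      intro k hkΔ
      obtain ⟨A, B, bad, hbad, hPbad, hAm, hBm, hAb, hBb, hAB, hgood⟩ := happrox k
      have hψm : AEStronglyMeasurable (fun ω ↦ ψ (fun i ↦ V k (S i) ω)) (P k) :=
        (hψC.measurable.comp_aemeasurable (hpVm k)).aestronglyMeasurable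
      have hFint : Integrable (fun ω ↦ F (pV k ω)) (P k) :=
        (integrable_const (2 * C)).mono'
          (hFm.comp_aemeasurable (hpVm k)).aestronglyMeasurable
          (ae_of_all _ fun ω ↦ hFb _)
      have hBAint : Integrable (fun ω ↦ (B ω - A ω) * ψ (fun i ↦ V k (S i) ω)) (P k) := by
        refine (integrable_const (2 * |C'|)).mono' ((hBm.sub hAm).mul hψm) ?_
        filter_upwards [hAb, hBb] with ω hA hB
        rw [norm_mul, Real.norm_eq_abs (ψ fun i ↦ V k (S i) ω)]
        have h1 : ‖B ω - A ω‖ ≤ 2 * |C'| :=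
          (norm_sub_le _ _).trans (by linarith [le_abs_self C'])
        calc ‖B ω - A ω‖ * |ψ fun i ↦ V k (S i) ω| ≤ 2 * |C'| * 1 :=
              mul_le_mul h1 (hψ1 _) (abs_nonneg _) (by positivity)
          _ = 2 * |C'| := mul_one _
      have hGint : Integrable (fun ω ↦ G Δ' (pV k ω)) (P k) :=
        (integrable_const (4 * C)).mono'
          ((hGm Δ').comp_aemeasurable (hpVm k)).aestronglyMeasurable
          (ae_of_all _ fun ω ↦ hGnorm _ _)
      have hIint : Integrable (bad.indicator fun _ ↦ (1 : ℝ)) (P k) :=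
        (integrable_const (1 : ℝ)).indicator hbad
      -- the pointwise bound
      set bound : Ω' k → ℝ := fun ω ↦
        2 * (ε k : ℝ) + G Δ' (pV k ω) + (2 * C + 2 * |C'|) * bad.indicator (fun _ ↦ (1 : ℝ)) ω
        with hbound
      have hbound_int : Integrable bound (P k) :=
        ((integrable_const _).add hGint).add (hIint.const_mul _)
      have hpt : ∀ᵐ ω ∂P k,
          ‖F (pV k ω) - (B ω - A ω) * ψ (fun i ↦ V k (S i) ω)‖ ≤ bound ω := by
        filter_upwards [hgood, hAb, hBb] with ω hω hA hB
        have hψle : |ψ (fun i ↦ V k (S i) ω)| ≤ 1 := hψ1 _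
        have hFp : F (pV k ω) =
            (N t (pV k ω) - N s (pV k ω)) * ψ (fun i ↦ V k (S i) ω) := rfl
        rw [hFp, ← sub_mul, norm_mul, Real.norm_eq_abs (ψ fun i ↦ V k (S i) ω)]
        have hdiff : N t (pV k ω) - N s (pV k ω) - (B ω - A ω) =
            (N t (pV k ω) - B ω) - (N s (pV k ω) - A ω) := by ring
        rw [hdiff]
        have hind0 : 0 ≤ bad.indicator (fun _ ↦ (1 : ℝ)) ω :=
          Set.indicator_nonneg (fun _ _ ↦ zero_le_one) _
        have hGω := hG0 Δ' (pV k ω)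
        by_cases hωbad : ω ∈ bad
        · have h1 : ‖N t (pV k ω) - B ω - (N s (pV k ω) - A ω)‖ ≤ 2 * C + 2 * |C'| :=
            calc ‖N t (pV k ω) - B ω - (N s (pV k ω) - A ω)‖
                ≤ ‖N t (pV k ω) - B ω‖ + ‖N s (pV k ω) - A ω‖ := norm_sub_le _ _
              _ ≤ (‖N t (pV k ω)‖ + ‖B ω‖) + (‖N s (pV k ω)‖ + ‖A ω‖) :=
                  add_le_add (norm_sub_le _ _) (norm_sub_le _ _)
              _ ≤ (C + |C'|) + (C + |C'|) :=
                  add_le_add (add_le_add (hNC _ _) (hB.trans (le_abs_self _)))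
                    (add_le_add (hNC _ _) (hA.trans (le_abs_self _)))
              _ = 2 * C + 2 * |C'| := by ring
          have hind : bad.indicator (fun _ ↦ (1 : ℝ)) ω = 1 := Set.indicator_of_mem hωbad _
          calc ‖N t (pV k ω) - B ω - (N s (pV k ω) - A ω)‖ * |ψ fun i ↦ V k (S i) ω|
              ≤ (2 * C + 2 * |C'|) * 1 := mul_le_mul h1 hψle (abs_nonneg _) (by positivity)
            _ ≤ bound ω := by
                show _ ≤ 2 * (ε k : ℝ) + G Δ' (pV k ω) +
                  (2 * C + 2 * |C'|) * bad.indicator (fun _ ↦ (1 : ℝ)) ω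
                rw [hind]
                linarith [(ε k).coe_nonneg]
        · obtain ⟨⟨uA, huA, hA'⟩, ⟨uB, huB, hB'⟩⟩ := hω hωbad
          have huA' : uA ∈ Icc s (s + Δ') := ⟨huA.1, huA.2.trans (add_le_add le_rfl hkΔ)⟩
          have huB' : uB ∈ Icc t (t + Δ') := ⟨huB.1, huB.2.trans (add_le_add le_rfl hkΔ)⟩
          have hoscB := (sSup_norm_sub_bounds_real hNC t Δ' (pV k ω)).2.2 uB huB'
          have hoscA := (sSup_norm_sub_bounds_real hNC s Δ' (pV k ω)).2.2 uA huA'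
          have htri : ∀ (x b nu : ℝ), ‖x - b‖ ≤ ‖nu - x‖ + ‖b - nu‖ := fun x b nu ↦ by
            calc ‖x - b‖ ≤ ‖x - nu‖ + ‖nu - b‖ := norm_sub_le_norm_sub_add_norm_sub _ _ _
              _ = ‖nu - x‖ + ‖b - nu‖ := by rw [norm_sub_rev x nu, norm_sub_rev nu b]
          have h1 : ‖N t (pV k ω) - B ω - (N s (pV k ω) - A ω)‖ ≤
              2 * (ε k : ℝ) + G Δ' (pV k ω) :=
            calc ‖N t (pV k ω) - B ω - (N s (pV k ω) - A ω)‖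
                ≤ ‖N t (pV k ω) - B ω‖ + ‖N s (pV k ω) - A ω‖ := norm_sub_le _ _
              _ ≤ (‖N uB (pV k ω) - N t (pV k ω)‖ + ‖B ω - N uB (pV k ω)‖) +
                    (‖N uA (pV k ω) - N s (pV k ω)‖ + ‖A ω - N uA (pV k ω)‖) :=
                  add_le_add (htri _ _ _) (htri _ _ _)
              _ ≤ (sSup ((fun u ↦ ‖N u (pV k ω) - N t (pV k ω)‖) '' Icc t (t + Δ')) + ε k) +
                    (sSup ((fun u ↦ ‖N u (pV k ω) - N s (pV k ω)‖) '' Icc s (s + Δ')) + ε k) :=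
                  add_le_add (add_le_add hoscB hB') (add_le_add hoscA hA')
              _ = 2 * (ε k : ℝ) + G Δ' (pV k ω) := by
                  show _ = 2 * (ε k : ℝ) + (_ + _)
                  ring
          calc ‖N t (pV k ω) - B ω - (N s (pV k ω) - A ω)‖ * |ψ fun i ↦ V k (S i) ω|
              ≤ (2 * (ε k : ℝ) + G Δ' (pV k ω)) * 1 :=
                mul_le_mul h1 hψle (abs_nonneg _) (by positivity)
            _ ≤ bound ω := by
                show _ ≤ 2 * (ε k : ℝ) + G Δ' (pV k ω) +
                  (2 * C + 2 * |C'|) * bad.indicator (fun _ ↦ (1 : ℝ)) ω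
                rw [mul_one]
                nlinarith [abs_nonneg C']
      -- integrate
      have hPreal : (P k).real bad ≤ η k := by
        rw [measureReal_def]
        exact ENNReal.toReal_le_coe_of_le_coe hPbad
      calc ‖∫ ω, F (pV k ω) ∂P k‖
          = ‖∫ ω, (F (pV k ω) - (B ω - A ω) * ψ (fun i ↦ V k (S i) ω)) ∂P k‖ := by
            rw [integral_sub hFint hBAint, hAB, sub_zero]
        _ ≤ ∫ ω, ‖F (pV k ω) - (B ω - A ω) * ψ (fun i ↦ V k (S i) ω)‖ ∂P k :=
            norm_integral_le_integral_norm _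
        _ ≤ ∫ ω, bound ω ∂P k := integral_mono_ae (hFint.sub hBAint).norm hbound_int hpt
        _ = 2 * (ε k : ℝ) + ∫ ω, G Δ' (pV k ω) ∂P k + (2 * C + 2 * |C'|) * (P k).real bad := by
            have hI1 : Integrable (fun ω ↦ 2 * (ε k : ℝ) + G Δ' (pV k ω)) (P k) :=
              (integrable_const _).add hGint
            have hI2 : Integrable
                (fun ω ↦ (2 * C + 2 * |C'|) * bad.indicator (fun _ ↦ (1 : ℝ)) ω) (P k) :=
              hIint.const_mul _
            show ∫ ω, (2 * (ε k : ℝ) + G Δ' (pV k ω) +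
              (2 * C + 2 * |C'|) * bad.indicator (fun _ ↦ (1 : ℝ)) ω) ∂P k = _
            rw [integral_add hI1 hI2, integral_add (integrable_const _) hGint,
              integral_const_mul (2 * C + 2 * |C'|), integral_indicator_const _ hbad, integral_const]
            simp
        _ ≤ 2 * (ε k : ℝ) + ∫ ω, G Δ' (pV k ω) ∂P k + (2 * C + 2 * |C'|) * (η k : ℝ) := by
            gcongr
    -- the limits as `k → ∞`
    have hlimF : Tendsto (fun k ↦ ∫ ω, F (pV k ω) ∂P k) atTop (𝓝 (∫ ω, F (pW ω) ∂μ)) :=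
      Process.tendsto_integral_comp_of_tendstoInDistribution_of_ae_continuousAt hlaw hFm hFb hFae
    have hlimG : Tendsto (fun k ↦ ∫ ω, G Δ' (pV k ω) ∂P k) atTop (𝓝 (∫ ω, G Δ' (pW ω) ∂μ)) :=
      Process.tendsto_integral_comp_of_tendstoInDistribution_of_ae_continuousAt hlaw (hGm Δ')
        (hGnorm Δ') (hGae Δ')
    have hε' : Tendsto (fun k ↦ (ε k : ℝ)) atTop (𝓝 0) := NNReal.tendsto_coe.2 hε
    have hη' : Tendsto (fun k ↦ (η k : ℝ)) atTop (𝓝 0) := NNReal.tendsto_coe.2 hη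
    have hlimRHS : Tendsto
        (fun k ↦ 2 * (ε k : ℝ) + ∫ ω, G Δ' (pV k ω) ∂P k + (2 * C + 2 * |C'|) * (η k : ℝ))
        atTop (𝓝 (2 * 0 + ∫ ω, G Δ' (pW ω) ∂μ + (2 * C + 2 * |C'|) * 0)) :=
      ((hε'.const_mul 2).add hlimG).add (hη'.const_mul _)
    rw [mul_zero, mul_zero, zero_add, add_zero] at hlimRHS
    have hev : ∀ᶠ k in atTop, Δ k ≤ Δ' := hΔ.eventually (Iic_mem_nhds hΔ')
    exact le_of_tendsto_of_tendsto hlimF.norm hlimRHS (hev.mono fun k hkΔ ↦ hk k hkΔ)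
  -- Step 2: `E_μ[G_{1/(m+1)}(W)] → 0` by dominated convergence
  have hpt0 : ∀ w : C(ℝ≥0, ℝ), Tendsto (fun m : ℕ ↦ G ((m : ℝ≥0) + 1)⁻¹ w) atTop (𝓝 0) := by
    intro w
    rw [Metric.tendsto_atTop]
    intro e he
    have hcu : ∀ u₀ : ℝ≥0, ∃ θ > 0, ∀ u : ℝ≥0, dist u u₀ < θ → ‖N u w - N u₀ w‖ < e / 4 := by
      intro u₀
      have hc : Continuous fun u : ℝ≥0 ↦ N u w := hNu w
      obtain ⟨θ, hθ, h⟩ := Metric.continuousAt_iff.1 (hc.continuousAt (x := u₀)) (e / 4)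
        (by positivity)
      exact ⟨θ, hθ, fun u hu ↦ by have := h hu; rwa [dist_eq_norm] at this⟩
    obtain ⟨θt, hθt, ht⟩ := hcu t
    obtain ⟨θs, hθs, hs⟩ := hcu s
    obtain ⟨m₀, hm₀⟩ := exists_nat_one_div_lt (lt_min hθt hθs)
    refine ⟨m₀, fun m hm ↦ ?_⟩
    have hθ' : ((((m : ℝ≥0) + 1)⁻¹ : ℝ≥0) : ℝ) < min θt θs := by
      have h1 : ((((m : ℝ≥0) + 1)⁻¹ : ℝ≥0) : ℝ) = 1 / ((m : ℝ) + 1) := by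
        simp only [NNReal.coe_inv, NNReal.coe_add, NNReal.coe_natCast, NNReal.coe_one, one_div]
      rw [h1]
      calc 1 / ((m : ℝ) + 1) ≤ 1 / ((m₀ : ℝ) + 1) :=
            one_div_le_one_div_of_le (by positivity)
              (by have : (m₀ : ℝ) ≤ m := by exact_mod_cast hm
                  linarith)
        _ < min θt θs := hm₀
    have hwithin : ∀ (u₀ : ℝ≥0) (θ : ℝ), min θt θs ≤ θ → ∀ u ∈ Icc u₀ (u₀ + ((m : ℝ≥0) + 1)⁻¹),
        dist u u₀ < θ := by
      intro u₀ θ hθ u hu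
      rw [NNReal.dist_eq]
      have h1 : (u₀ : ℝ) ≤ u := NNReal.coe_le_coe.2 hu.1
      have h2 : (u : ℝ) ≤ u₀ + ((((m : ℝ≥0) + 1)⁻¹ : ℝ≥0) : ℝ) := by
        have := NNReal.coe_le_coe.2 hu.2
        rwa [NNReal.coe_add] at this
      rw [abs_of_nonneg (by linarith)]
      linarith
    have hbt : sSup ((fun u ↦ ‖N u w - N t w‖) '' Icc t (t + ((m : ℝ≥0) + 1)⁻¹)) ≤ e / 4 := by
      refine csSup_le ⟨_, t, ⟨le_rfl, le_self_add⟩, rfl⟩ ?_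
      rintro _ ⟨u, hu, rfl⟩
      exact (ht u (hwithin t θt (min_le_left _ _) u hu)).le
    have hbs : sSup ((fun u ↦ ‖N u w - N s w‖) '' Icc s (s + ((m : ℝ≥0) + 1)⁻¹)) ≤ e / 4 := by
      refine csSup_le ⟨_, s, ⟨le_rfl, le_self_add⟩, rfl⟩ ?_
      rintro _ ⟨u, hu, rfl⟩
      exact (hs u (hwithin s θs (min_le_right _ _) u hu)).le
    rw [Real.dist_eq, sub_zero, abs_of_nonneg (hG0 _ _)]
    calc G ((m : ℝ≥0) + 1)⁻¹ w = _ + _ := rfl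
      _ ≤ e / 4 + e / 4 := add_le_add hbt hbs
      _ < e := by linarith
  have hG_tend : Tendsto (fun m : ℕ ↦ ∫ ω, G ((m : ℝ≥0) + 1)⁻¹ (pW ω) ∂μ) atTop (𝓝 0) := by
    have := tendsto_integral_of_dominated_convergence (μ := μ)
      (F := fun (m : ℕ) ω ↦ G ((m : ℝ≥0) + 1)⁻¹ (pW ω)) (f := fun _ ↦ (0 : ℝ)) (fun _ ↦ 4 * C)
      (fun m ↦ ((hGm _).comp_aemeasurable hpWm).aestronglyMeasurable)
      (integrable_const _) (fun m ↦ ae_of_all _ fun ω ↦ hGnorm _ _)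
      (ae_of_all _ fun ω ↦ hpt0 (pW ω))
    simpa using this
  -- Step 3: conclusion
  have hle : ∀ m : ℕ, ‖∫ ω, F (pW ω) ∂μ‖ ≤ ∫ ω, G ((m : ℝ≥0) + 1)⁻¹ (pW ω) ∂μ := fun m ↦
    hstep _ (inv_pos.2 (by positivity))
  exact norm_le_zero_iff.1 (ge_of_tendsto' hG_tend hle)

end Passage

end Loewner

end Literature.Probability.RandomPlanarGeometry

end
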